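import Literature.IUT.LogThetaLattice.VerticallyCoricLGPBad
import HarnessLib

/-!
# [IUTchIII] Proposition 3.7 (ii) at the model of a nonarchimedean place: the local fractional ideals `𝔍_v`
# lie in `𝓘^ℚ` and their `ℚ`-span is all of `𝓘^ℚ`

Proof-only companion (abc-iut cell, layer L6, D-0067 wave-4 discharge seat abc-iut-w4-d005, board row F10-a =
[IUTchIII] Prop. 3.7 (i)(ii); node IUTchIII:Prop3.7(ii)) of abc-iut-L6-t4's `ThetaPilotObjects.lean` (Prop. 3.7
output signature) / `TensorPackets.lean` (`shellQSpan`) and of `VerticallyCoricLGPBad.lean` (the tree's model of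
a nonarchimedean place: `𝓘^ℚ = K`). NO new definitions.

S. Mochizuki, *Inter-universal Teichmüller Theory III*, kurims manuscript (May 2020), Proposition 3.7 (ii),
p. 110 l. 29–44 [claim key Mochizuki2012, status disputed (D-0012)]: the Frobenioid `(†𝓕⊛_𝔪𝔬𝔡)_α` is
constructed "from the [number] field `(†𝕄⊛_𝔪𝔬𝔡)_α := (†𝕄⊛_MOD)_α` … and the Galois invariants of the local monoids
`Ψ_{log(^{A,α}𝓕_v)} ⊆ log(^{A,α}𝓕_v)` for `v ∈ 𝕍` of Proposition 3.4, (i) — i.e., so the corresponding local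
'fractional ideal `𝔍_v`' of Example 3.6, (ii), is a subset [indeed a submodule when `v ∈ 𝕍^non`] of
`𝓘^ℚ(^{A,α}𝓕_v)` whose `ℚ`-span is equal to `𝓘^ℚ(^{A,α}𝓕_v)` [cf. the notational conventions of Proposition 3.2,
(ii)]".

THIS FILE discharges that parenthetical AT THE MODEL of one nonarchimedean factor (the model of the tree's
`VerticallyCoricLGPBad.lean`: `K` a mixed-characteristic ultrametric field, `NormedAlgebra ℚ_[p] K`; a model
`Lg : PadicLogOnUnits K` of the `p`-adic logarithm with log-shell `ℐ = logShell Lg`; `𝓘^ℚ` = abc-iut-L6-t4's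
`shellQSpan` of the subgroup generated by `ℐ`, typed as the `ℚ_p`-span), for the local fractional ideals
`𝔍_v = λ·𝒪_{K_v}` (`λ ≠ 0`; `𝒪_{K_v}` = the closed unit ball) — in particular for those "generated by elements of
the monoids `Ψ`" (`λ ∈ 𝒪^▷`), which is how Prop. 3.7 (v) / Def. 3.8 (i) use them:
* `smul_closedBall_subset_shellQSpan` — `𝔍_v ⊆ 𝓘^ℚ` ("is a subset of `𝓘^ℚ(^{A,α}𝓕_v)`");
* `add_mem_smul_closedBall`, `mul_mem_smul_closedBall` — `𝔍_v` is an `𝒪_{K_v}`-submodule of `K_v` ("indeed a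
  submodule when `v ∈ 𝕍^non`");
* **`span_smul_closedBall_eq_top`**, **`span_smul_closedBall_eq_shellQSpan`** — the `ℚ_p`-span of `𝔍_v` is all of
  `K = 𝓘^ℚ` ("whose `ℚ`-span is equal to `𝓘^ℚ(^{A,α}𝓕_v)`", in abc-iut-L6-t4's `ℚ_p`-span typing of `𝓘^ℚ`);
* **`span_rat_smul_closedBall_eq_top`** — the same with the literal `ℚ`-span of print (`x = p^{-n}·(p^n x)`).

HONEST SCOPE: one factor at one nonarchimedean place (the packet statement is the image under abc-iut-L6-t4's
`toPacketAt`, cf. `VerticallyCoricLGPBadPackets.lean`); the archimedean `𝔍_v` ("a positive real multiple of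
`𝒪_{K_v}`") is not treated here. Nothing in this file takes a side on [IUTchIII] Cor. 3.12; typed ≠ discharged
elsewhere; what is proved is elementary nonarchimedean analysis.
-/

noncomputable section

namespace Literature.IUT.LogThetaLattice

open Set Metric
open scoped Pointwise
open Literature.AnabelianGeometry.AbsoluteAnabelian

universe u

section NonarchPlace

variable (p : ℕ) [Fact p.Prime]
variable {K : Type u} [NontriviallyNormedField K] [NormedAlgebra ℚ_[p] K] [IsUltrametricDist K]
variable (Lg : PadicLogOnUnits K)

omit [NormedAlgebra ℚ_[p] K] [IsUltrametricDist K] in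
/-- In a mixed-characteristic ultrametric field every element becomes integral after multiplication by a
power of `p`: `‖p‖^n · ‖x‖ ≤ 1` for some `n`. [folklore] -/
private theorem exists_norm_p_pow_mul_le_one (x : K) : ∃ n : ℕ, ‖(p : ℚ_[p])‖ ^ n * ‖x‖ ≤ 1 := by
  have hprime : p.Prime := Fact.out
  have hp1 : ‖(p : ℚ_[p])‖ < 1 := by
    rw [Padic.norm_p]
    exact inv_lt_one_of_one_lt₀ (by exact_mod_cast hprime.one_lt)
  rcases eq_or_ne x 0 with rfl | hx
  · exact ⟨0, by simp⟩
  · have hxpos : 0 < ‖x‖ := norm_pos_iff.mpr hx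
    obtain ⟨n, hn⟩ := exists_pow_lt_of_lt_one (inv_pos.mpr hxpos) hp1
    have h := mul_lt_mul_of_pos_right hn hxpos
    rw [inv_mul_cancel₀ hxpos.ne'] at h
    exact ⟨n, h.le⟩

omit [IsUltrametricDist K] in
/-- **[IUTchIII] Prop. 3.7 (ii), "whose `ℚ`-span is equal to `𝓘^ℚ(^{A,α}𝓕_v)`" — the span is everything**: for
`λ ≠ 0` the `ℚ_p`-span of the local fractional ideal `𝔍_v = λ·𝒪_{K_v}` is all of `K_v` (every `x` is
`p^{-n}·(λ·(p^n λ^{-1} x))` with `p^n λ^{-1} x ∈ 𝒪_{K_v}`). [claim: Mochizuki2012, status: disputed] -/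
theorem span_smul_closedBall_eq_top {lam : K} (hlam : lam ≠ 0) :
    Submodule.span ℚ_[p] (lam • closedBall (0 : K) 1) = ⊤ := by
  have hprime : p.Prime := Fact.out
  have hp0 : (p : ℚ_[p]) ≠ 0 := by exact_mod_cast hprime.ne_zero
  refine Submodule.eq_top_iff'.mpr fun x => ?_
  obtain ⟨n, hn⟩ := exists_norm_p_pow_mul_le_one p (lam⁻¹ * x)
  have hy : ((p : ℚ_[p]) ^ n) • (lam⁻¹ * x) ∈ closedBall (0 : K) 1 := by
    rw [mem_closedBall, dist_zero_right, norm_smul, norm_pow]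
    exact hn
  have hmem : lam • (((p : ℚ_[p]) ^ n) • (lam⁻¹ * x)) ∈
      Submodule.span ℚ_[p] (lam • closedBall (0 : K) 1) :=
    Submodule.subset_span (smul_mem_smul_set hy)
  have h := Submodule.smul_mem _ (((p : ℚ_[p]) ^ n)⁻¹) hmem
  rwa [smul_eq_mul, mul_smul_comm, smul_smul, inv_mul_cancel₀ (pow_ne_zero n hp0), one_smul, ← mul_assoc,
    mul_inv_cancel₀ hlam, one_mul] at h

/-- **[IUTchIII] Prop. 3.7 (ii), "whose `ℚ`-span is equal to `𝓘^ℚ(^{A,α}𝓕_v)`"** at the model: the `ℚ_p`-span of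
`𝔍_v = λ·𝒪_{K_v}` (`λ ≠ 0`) EQUALS `𝓘^ℚ` = abc-iut-L6-t4's `shellQSpan` of the log-shell `ℐ` (both are all of `K_v`:
`VerticallyCoricLGPBad.shellQSpan_closure_logShell_eq_top`). [claim: Mochizuki2012, status: disputed] -/
theorem span_smul_closedBall_eq_shellQSpan {lam : K} (hlam : lam ≠ 0) :
    Submodule.span ℚ_[p] (lam • closedBall (0 : K) 1) =
      shellQSpan ℚ_[p] (AddSubgroup.closure (logShell Lg)) := by
  rw [span_smul_closedBall_eq_top p hlam, shellQSpan_closure_logShell_eq_top p Lg]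

/-- **[IUTchIII] Prop. 3.7 (ii), "is a subset … of `𝓘^ℚ(^{A,α}𝓕_v)`"** at the model: `𝔍_v = λ·𝒪_{K_v} ⊆ 𝓘^ℚ`
(for ANY `λ`). [claim: Mochizuki2012, status: disputed] -/
theorem smul_closedBall_subset_shellQSpan (lam : K) :
    lam • closedBall (0 : K) 1 ⊆ (shellQSpan ℚ_[p] (AddSubgroup.closure (logShell Lg)) : Set K) := by
  intro x _
  have h : x ∈ (⊤ : Submodule ℚ_[p] K) := Submodule.mem_top
  rw [← shellQSpan_closure_logShell_eq_top p Lg] at h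
  exact h

omit [NormedAlgebra ℚ_[p] K] in
/-- **[IUTchIII] Prop. 3.7 (ii), "indeed a submodule when `v ∈ 𝕍^non`"** — closed under addition: by the
ultrametric inequality `𝒪_{K_v}` is an additive subgroup, hence so is `λ·𝒪_{K_v}`. [claim: Mochizuki2012, status: disputed] -/
theorem add_mem_smul_closedBall (lam : K) {x y : K} (hx : x ∈ lam • closedBall (0 : K) 1)
    (hy : y ∈ lam • closedBall (0 : K) 1) : x + y ∈ lam • closedBall (0 : K) 1 := by
  obtain ⟨a, ha, rfl⟩ := mem_smul_set.mp hx
  obtain ⟨b, hb, rfl⟩ := mem_smul_set.mp hy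
  refine mem_smul_set.mpr ⟨a + b, ?_, by rw [smul_eq_mul, smul_eq_mul, smul_eq_mul, mul_add]⟩
  rw [mem_closedBall, dist_zero_right] at ha hb ⊢
  exact (IsUltrametricDist.norm_add_le_max a b).trans (max_le ha hb)

omit [NormedAlgebra ℚ_[p] K] [IsUltrametricDist K] in
/-- **[IUTchIII] Prop. 3.7 (ii), "indeed a submodule when `v ∈ 𝕍^non`"** — stable under `𝒪_{K_v}`: for `c` in
the unit ball and `x ∈ λ·𝒪_{K_v}`, `c·x ∈ λ·𝒪_{K_v}` (sub-multiplicativity of the norm). [claim: Mochizuki2012, status: disputed] -/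
theorem mul_mem_smul_closedBall (lam : K) {c x : K} (hc : c ∈ closedBall (0 : K) 1)
    (hx : x ∈ lam • closedBall (0 : K) 1) : c * x ∈ lam • closedBall (0 : K) 1 := by
  obtain ⟨a, ha, rfl⟩ := mem_smul_set.mp hx
  refine mem_smul_set.mpr ⟨c * a, ?_, by rw [smul_eq_mul, smul_eq_mul, mul_left_comm]⟩
  rw [mem_closedBall, dist_zero_right] at ha hc ⊢
  calc ‖c * a‖ ≤ ‖c‖ * ‖a‖ := norm_mul_le c a
    _ ≤ 1 * 1 := mul_le_mul hc ha (norm_nonneg a) zero_le_one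
    _ = 1 := one_mul 1

omit [NormedAlgebra ℚ_[p] K] [IsUltrametricDist K] in
/-- The generator lies in its fractional ideal: `λ = λ·1 ∈ λ·𝒪_{K_v}` — so a fractional ideal "generated by [an]
element of the monoid" `Ψ^▷` ([IUTchIII] Prop. 3.7 (v) p. 112, Def. 3.8 (i)) contains that element.
[claim: Mochizuki2012, status: disputed] -/
theorem self_mem_smul_closedBall (lam : K) : lam ∈ lam • closedBall (0 : K) 1 :=
  mem_smul_set.mpr ⟨1, by simp, by rw [smul_eq_mul, mul_one]⟩

omit [IsUltrametricDist K] in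
include p in
/-- **[IUTchIII] Prop. 3.7 (ii) with the LITERAL `ℚ`-span of print**: for `λ ≠ 0` the `ℚ`-span of
`𝔍_v = λ·𝒪_{K_v}` is already all of `K_v` (`K_v` of characteristic zero, a `ℚ`-vector space) — every `x` is
`p^{-n}·(λ·(p^n λ^{-1} x))` with a RATIONAL scalar `p^{-n}` — hence a fortiori equals the `ℚ`-span of the
log-shell `ℐ ⊇ 𝒪_{K_v}`. [claim: Mochizuki2012, status: disputed] -/
theorem span_rat_smul_closedBall_eq_top [CharZero K] {lam : K} (hlam : lam ≠ 0) :
    Submodule.span ℚ (lam • closedBall (0 : K) 1) = ⊤ := by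
  have hprime : p.Prime := Fact.out
  have hpK : (p : K) ≠ 0 := by
    have h : algebraMap ℚ_[p] K (p : ℚ_[p]) = (p : K) := map_natCast _ p
    rw [← h, map_ne_zero]
    exact_mod_cast hprime.ne_zero
  refine Submodule.eq_top_iff'.mpr fun x => ?_
  obtain ⟨n, hn⟩ := exists_norm_p_pow_mul_le_one p (lam⁻¹ * x)
  -- `p^n · (λ⁻¹ x)` lies in the unit ball: compute its norm through `ℚ_p`
  have hy : (p : K) ^ n * (lam⁻¹ * x) ∈ closedBall (0 : K) 1 := by
    have h : ((p : ℚ_[p]) ^ n) • (lam⁻¹ * x) = (p : K) ^ n * (lam⁻¹ * x) := by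
      rw [Algebra.smul_def, map_pow, map_natCast]
    rw [mem_closedBall, dist_zero_right, ← h, norm_smul, norm_pow]
    exact hn
  have hmem : lam • ((p : K) ^ n * (lam⁻¹ * x)) ∈ Submodule.span ℚ (lam • closedBall (0 : K) 1) :=
    Submodule.subset_span (smul_mem_smul_set hy)
  have h := Submodule.smul_mem _ (((p : ℚ) ^ n)⁻¹) hmem
  have hscal : (((p : ℚ) ^ n)⁻¹ : ℚ) • (lam • ((p : K) ^ n * (lam⁻¹ * x))) = x := by
    rw [smul_eq_mul, Rat.smul_def, Rat.cast_inv, Rat.cast_pow, Rat.cast_natCast, ← mul_assoc, ← mul_assoc,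
      mul_comm (((p : K) ^ n)⁻¹) lam, mul_assoc lam, inv_mul_cancel₀ (pow_ne_zero n hpK), mul_one,
      ← mul_assoc, mul_inv_cancel₀ hlam, one_mul]
  rwa [hscal] at h

end NonarchPlace

end Literature.IUT.LogThetaLattice

end
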